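import Summits.KontsevichZagierPeriods.KontsevichZagierPeriods.Theorems.LinRedNormalFormWheelThreeSpokesCharts

/-!
# `WheelThreeSpokes` (stmt-KontsevichZagierPeriods-3913), line `laplacian-ldl-chart`: the two
dihedral charts

Stub `stub_dihedralCharts` of the line `laplacian-ldl-chart` (crux `WheelThreeSpokes`,
`[ℝ₊⁵, 1/Ψ_{K₄}(x,1)²] ~ [Δ₃, 6/(t₀t₁(1−t₂))]`). After the two Newton–Leibniz descents the chain
sits on two cells of dimension three, in coordinates `(u, v, s)`:

* `E = [BE, (s−u)/(u(1−u)(1−s)(1−u−v)s)]`, `BE = {0 < u, 0 < v, u+v < 1, u < s, s(u+v) < u}`;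
* `F = [BF, 1/((1−u)vs)]`, `BF = {0 < u, 0 < v, u+v < 1, u < s(u+v), s < 1}`.

The substitution `t = u/(u+v)` (i.e. `v = u(1−t)/t`) puts both on the simplex
`Δ₃ = {1 > t₀ > t₁ > t₂ > 0}` with the dihedral integrands
`E_dih(t) = (t₁−t₂)/(t₀(t₀−t₂)(1−t₂)(1−t₁)t₁)` and `F_dih(t) = 1/(t₀t₁(1−t₁)(1−t₂))`:
two changes of variables (Kontsevich–Zagier rule (2)) along the RATIONAL charts

* `C_E(u,v,s) = (u/(u+v), s, u) : BE → Δ₃` (inverse `t ↦ (t₂, t₂(1−t₀)/t₀, t₁)`),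
  `C_E = P/Q` with `P = (y₀, y₂, y₀)`, `Q = (y₀+y₁, 1, 1)`, Jacobian determinant `−u/(u+v)²`;
* `C_F(u,v,s) = (s, u/(u+v), u) : BF → Δ₃` (inverse `t ↦ (t₂, t₂(1−t₁)/t₁, t₀)`),
  `C_F = P/Q` with `P = (y₂, y₀, y₀)`, `Q = (1, y₀+y₁, 1)`, Jacobian determinant `u/(u+v)²`,

each ONE application of `ratChart_transport` (`LinRedNormalFormWheelThreeSpokesCharts.lean`).
This file: values, injectivity and images of the two charts, the pull-back identities
`g = (h ∘ C)·|J|`, and the assembly (the `3 × 3` Jacobian determinants are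
`Matrix.det_fin_three` computations done in place); absolute integrability of the `E`/`F` side
is transported from the given simplex representations.

References: M. Kontsevich, D. Zagier, *Periods* (2001), §1.2 rule (2); J. Bochnak, M. Coste,
M.-F. Roy, *Real Algebraic Geometry* (1998), §2.2.
-/

noncomputable section

open Set MeasureTheory MvPolynomial
open Literature.NumberTheory.Transcendental
open Literature.ModelTheory.ExponentialFields (IsSemialgebraic isSemialgebraic_setOf_eval_lt)

namespace Summit.KontsevichZagierPeriods.LinRedNormalForm.WheelThreeSpokes

namespace DihedralCharts

/-! ## Semialgebraic cells and non-vanishing denominators -/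

/-- `BE = {0 < u, 0 < v, u+v < 1, u < s, s(u+v) < u}` is `ℚ`-semialgebraic (five strict
polynomial inequalities). [cite: BochnakCosteRoy1998, Def. 2.1.4] -/
theorem isSemialgebraic_BE : IsSemialgebraic ℚ {e : Fin 3 → ℝ | 0 < e 0 ∧ 0 < e 1 ∧
    e 0 + e 1 < 1 ∧ e 0 < e 2 ∧ e 2 * (e 0 + e 1) < e 0} := by
  have h := BeukersZeta3.isSemialgebraic_setOf_six_lt 0 (X 0) 0 (X 1) (X 0 + X 1) 1 (X 0) (X 2)
    (X 2 * (X 0 + X 1)) (X 0) 0 (X 0)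
  simp only [map_zero, map_one, map_add, map_mul, aeval_X] at h
  convert h using 1
  ext x
  simp only [mem_setOf_eq]
  tauto

/-- `BF = {0 < u, 0 < v, u+v < 1, u < s(u+v), s < 1}` is `ℚ`-semialgebraic (five strict
polynomial inequalities). [cite: BochnakCosteRoy1998, Def. 2.1.4] -/
theorem isSemialgebraic_BF : IsSemialgebraic ℚ {f : Fin 3 → ℝ | 0 < f 0 ∧ 0 < f 1 ∧
    f 0 + f 1 < 1 ∧ f 0 < f 2 * (f 0 + f 1) ∧ f 2 < 1} := by
  have h := BeukersZeta3.isSemialgebraic_setOf_six_lt 0 (X 0) 0 (X 1) (X 0 + X 1) 1 (X 0)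
    (X 2 * (X 0 + X 1)) (X 2) 1 0 (X 0)
  simp only [map_zero, map_one, map_add, map_mul, aeval_X] at h
  convert h using 1
  ext x
  simp only [mem_setOf_eq]
  tauto

/-- The denominators `Q = (u+v, 1, 1)` of `C_E` do not vanish when `u, v > 0`. [folklore] -/
theorem aeval_QE_ne_zero (y : Fin 3 → ℝ) (h0 : 0 < y 0) (h1 : 0 < y 1) (i : Fin 3) :
    aeval y ((![X 0 + X 1, 1, 1] : Fin 3 → MvPolynomial (Fin 3) ℚ) i) ≠ 0 := by
  have h01 : y 0 + y 1 ≠ 0 := by positivity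
  fin_cases i <;> simp [h01]

/-- The denominators `Q = (1, u+v, 1)` of `C_F` do not vanish when `u, v > 0`. [folklore] -/
theorem aeval_QF_ne_zero (y : Fin 3 → ℝ) (h0 : 0 < y 0) (h1 : 0 < y 1) (i : Fin 3) :
    aeval y ((![1, X 0 + X 1, 1] : Fin 3 → MvPolynomial (Fin 3) ℚ) i) ≠ 0 := by
  have h01 : y 0 + y 1 ≠ 0 := by positivity
  fin_cases i <;> simp [h01]

/-- The Jacobian denominator `(u+v)²` of both charts does not vanish when `u, v > 0`.
[folklore] -/
theorem aeval_JQ_ne_zero (y : Fin 3 → ℝ) (h0 : 0 < y 0) (h1 : 0 < y 1) :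
    aeval y ((X 0 + X 1) ^ 2 : MvPolynomial (Fin 3) ℚ) ≠ 0 := by
  simp only [map_pow, map_add, aeval_X]
  positivity

/-! ## The two charts: values, injectivity, images -/

/-- Values of the chart `C_E(u,v,s) = (u/(u+v), s, u)`. [folklore] -/
theorem chartE_apply (x : Fin 3 → ℝ) :
    (fun i : Fin 3 => aeval x ((![X 0, X 2, X 0] : Fin 3 → MvPolynomial (Fin 3) ℚ) i) /
        aeval x ((![X 0 + X 1, 1, 1] : Fin 3 → MvPolynomial (Fin 3) ℚ) i)) =
      ![x 0 / (x 0 + x 1), x 2, x 0] := by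
  funext i; fin_cases i <;> simp

/-- Values of the chart `C_F(u,v,s) = (s, u/(u+v), u)`. [folklore] -/
theorem chartF_apply (x : Fin 3 → ℝ) :
    (fun i : Fin 3 => aeval x ((![X 2, X 0, X 0] : Fin 3 → MvPolynomial (Fin 3) ℚ) i) /
        aeval x ((![1, X 0 + X 1, 1] : Fin 3 → MvPolynomial (Fin 3) ℚ) i)) =
      ![x 2, x 0 / (x 0 + x 1), x 0] := by
  funext i; fin_cases i <;> simp

/-- `C_E` is injective on `BE` (`u` and `s` are coordinates of the image, and `u/(u+v)`
determines `v` once `u > 0` is known). [folklore] -/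
theorem injOn_chartE :
    InjOn (fun (x : Fin 3 → ℝ) (i : Fin 3) =>
        aeval x ((![X 0, X 2, X 0] : Fin 3 → MvPolynomial (Fin 3) ℚ) i) /
          aeval x ((![X 0 + X 1, 1, 1] : Fin 3 → MvPolynomial (Fin 3) ℚ) i))
      {e : Fin 3 → ℝ | 0 < e 0 ∧ 0 < e 1 ∧ e 0 + e 1 < 1 ∧ e 0 < e 2 ∧ e 2 * (e 0 + e 1) < e 0} := by
  intro x hx x' hx' h
  beta_reduce at h
  rw [chartE_apply, chartE_apply] at h
  have h0 := congrFun h 0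
  have h1 := congrFun h 1
  have h2 := congrFun h 2
  simp only [Matrix.cons_val_zero, Matrix.cons_val_one, Matrix.cons_val_two, Matrix.head_cons,
    Matrix.tail_cons] at h0 h1 h2
  obtain ⟨hx0, hx1, -, -, -⟩ := hx
  obtain ⟨hx0', hx1', -, -, -⟩ := hx'
  have hs : 0 < x 0 + x 1 := by positivity
  have hs' : 0 < x' 0 + x' 1 := by positivity
  rw [div_eq_div_iff hs.ne' hs'.ne', ← h2] at h0
  have hsum : x 0 + x' 1 = x 0 + x 1 := mul_left_cancel₀ hx0.ne' h0
  funext i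
  fin_cases i
  · exact h2
  · show x 1 = x' 1
    linarith
  · exact h1

/-- `C_F` is injective on `BF`. [folklore] -/
theorem injOn_chartF :
    InjOn (fun (x : Fin 3 → ℝ) (i : Fin 3) =>
        aeval x ((![X 2, X 0, X 0] : Fin 3 → MvPolynomial (Fin 3) ℚ) i) /
          aeval x ((![1, X 0 + X 1, 1] : Fin 3 → MvPolynomial (Fin 3) ℚ) i))
      {f : Fin 3 → ℝ | 0 < f 0 ∧ 0 < f 1 ∧ f 0 + f 1 < 1 ∧ f 0 < f 2 * (f 0 + f 1) ∧ f 2 < 1} := by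
  intro x hx x' hx' h
  beta_reduce at h
  rw [chartF_apply, chartF_apply] at h
  have h0 := congrFun h 0
  have h1 := congrFun h 1
  have h2 := congrFun h 2
  simp only [Matrix.cons_val_zero, Matrix.cons_val_one, Matrix.cons_val_two, Matrix.head_cons,
    Matrix.tail_cons] at h0 h1 h2
  obtain ⟨hx0, hx1, -, -, -⟩ := hx
  obtain ⟨hx0', hx1', -, -, -⟩ := hx'
  have hs : 0 < x 0 + x 1 := by positivity
  have hs' : 0 < x' 0 + x' 1 := by positivity
  rw [div_eq_div_iff hs.ne' hs'.ne', ← h2] at h1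
  have hsum : x 0 + x' 1 = x 0 + x 1 := mul_left_cancel₀ hx0.ne' h1
  funext i
  fin_cases i
  · exact h2
  · show x 1 = x' 1
    linarith
  · exact h0

/-- `C_E` maps `BE` onto the simplex `1 > t₀ > t₁ > t₂ > 0` (inverse
`t ↦ (t₂, t₂(1−t₀)/t₀, t₁)`). [folklore] -/
theorem image_chartE :
    (fun (x : Fin 3 → ℝ) (i : Fin 3) =>
        aeval x ((![X 0, X 2, X 0] : Fin 3 → MvPolynomial (Fin 3) ℚ) i) /
          aeval x ((![X 0 + X 1, 1, 1] : Fin 3 → MvPolynomial (Fin 3) ℚ) i)) ''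
      {e : Fin 3 → ℝ | 0 < e 0 ∧ 0 < e 1 ∧ e 0 + e 1 < 1 ∧ e 0 < e 2 ∧ e 2 * (e 0 + e 1) < e 0} =
      {t : Fin 3 → ℝ | 1 > t 0 ∧ t 0 > t 1 ∧ t 1 > t 2 ∧ t 2 > 0} := by
  ext t
  constructor
  · rintro ⟨x, ⟨h0, h1, h01, h02, h2⟩, rfl⟩
    simp only [mem_setOf_eq, chartE_apply, Matrix.cons_val_zero, Matrix.cons_val_one,
      Matrix.cons_val_two, Matrix.head_cons, Matrix.tail_cons, gt_iff_lt]
    have hs : 0 < x 0 + x 1 := by positivity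
    refine ⟨?_, ?_, h02, h0⟩
    · rw [div_lt_one hs]
      linarith
    · rw [lt_div_iff₀ hs]
      exact h2
  · rintro ⟨h0, h01, h12, h2⟩
    have ht1 : 0 < t 1 := lt_trans h2 h12
    have ht0 : 0 < t 0 := lt_trans ht1 h01
    have hsum : t 2 + t 2 * (1 - t 0) / t 0 = t 2 / t 0 := by
      field_simp
      ring
    refine ⟨![t 2, t 2 * (1 - t 0) / t 0, t 1], ?_, ?_⟩
    · simp only [mem_setOf_eq, Matrix.cons_val_zero, Matrix.cons_val_one, Matrix.cons_val_two,
        Matrix.head_cons, Matrix.tail_cons]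
      rw [hsum]
      refine ⟨h2, div_pos (mul_pos h2 (by linarith)) ht0, ?_, h12, ?_⟩
      · rw [div_lt_one ht0]
        linarith
      · rw [← mul_div_assoc, div_lt_iff₀ ht0]
        nlinarith
    · beta_reduce
      rw [chartE_apply]
      funext i
      fin_cases i
      · show t 2 / (t 2 + t 2 * (1 - t 0) / t 0) = t 0
        rw [hsum]
        field_simp
      · simp
      · simp

/-- `C_F` maps `BF` onto the simplex `1 > t₀ > t₁ > t₂ > 0` (inverse
`t ↦ (t₂, t₂(1−t₁)/t₁, t₀)`). [folklore] -/
theorem image_chartF :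
    (fun (x : Fin 3 → ℝ) (i : Fin 3) =>
        aeval x ((![X 2, X 0, X 0] : Fin 3 → MvPolynomial (Fin 3) ℚ) i) /
          aeval x ((![1, X 0 + X 1, 1] : Fin 3 → MvPolynomial (Fin 3) ℚ) i)) ''
      {f : Fin 3 → ℝ | 0 < f 0 ∧ 0 < f 1 ∧ f 0 + f 1 < 1 ∧ f 0 < f 2 * (f 0 + f 1) ∧ f 2 < 1} =
      {t : Fin 3 → ℝ | 1 > t 0 ∧ t 0 > t 1 ∧ t 1 > t 2 ∧ t 2 > 0} := by
  ext t
  constructor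
  · rintro ⟨x, ⟨h0, h1, h01, h02, h2⟩, rfl⟩
    simp only [mem_setOf_eq, chartF_apply, Matrix.cons_val_zero, Matrix.cons_val_one,
      Matrix.cons_val_two, Matrix.head_cons, Matrix.tail_cons, gt_iff_lt]
    have hs : 0 < x 0 + x 1 := by positivity
    refine ⟨h2, ?_, ?_, h0⟩
    · rw [div_lt_iff₀ hs]
      exact h02
    · rw [lt_div_iff₀ hs]
      nlinarith
  · rintro ⟨h0, h01, h12, h2⟩
    have ht1 : 0 < t 1 := lt_trans h2 h12
    have ht0 : 0 < t 0 := lt_trans ht1 h01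
    have hsum : t 2 + t 2 * (1 - t 1) / t 1 = t 2 / t 1 := by
      field_simp
      ring
    refine ⟨![t 2, t 2 * (1 - t 1) / t 1, t 0], ?_, ?_⟩
    · simp only [mem_setOf_eq, Matrix.cons_val_zero, Matrix.cons_val_one, Matrix.cons_val_two,
        Matrix.head_cons, Matrix.tail_cons]
      rw [hsum]
      refine ⟨h2, div_pos (mul_pos h2 (by linarith)) ht1, ?_, ?_, h0⟩
      · rw [div_lt_one ht1]
        exact h12
      · rw [← mul_div_assoc, lt_div_iff₀ ht1]
        nlinarith
    · beta_reduce
      rw [chartF_apply]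
      funext i
      fin_cases i
      · simp
      · show t 2 / (t 2 + t 2 * (1 - t 1) / t 1) = t 1
        rw [hsum]
        field_simp
      · simp

/-! ## Pull-back identities `g = (h ∘ C)·|J|` -/

/-- Pull-back identity for `C_E`: `gE(u,v,s) = E_dih(u/(u+v), s, u) · |−u/(u+v)²|` on `BE`.
[folklore] -/
theorem hgh_chartE : ∀ y ∈ {e : Fin 3 → ℝ | 0 < e 0 ∧ 0 < e 1 ∧ e 0 + e 1 < 1 ∧ e 0 < e 2 ∧
      e 2 * (e 0 + e 1) < e 0},
    (fun e : Fin 3 → ℝ => (e 2 - e 0) / (e 0 * (1 - e 0) * (1 - e 2) * (1 - e 0 - e 1) * e 2)) y =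
    (fun t : Fin 3 → ℝ => (t 1 - t 2) / (t 0 * (t 0 - t 2) * (1 - t 2) * (1 - t 1) * t 1))
      (fun i : Fin 3 => aeval y ((![X 0, X 2, X 0] : Fin 3 → MvPolynomial (Fin 3) ℚ) i) /
        aeval y ((![X 0 + X 1, 1, 1] : Fin 3 → MvPolynomial (Fin 3) ℚ) i)) *
      |aeval y (-X 0 : MvPolynomial (Fin 3) ℚ) / aeval y ((X 0 + X 1) ^ 2 : MvPolynomial (Fin 3) ℚ)| := by
  rintro y ⟨h0, h1, h01, h02, h2⟩
  rw [chartE_apply]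
  simp only [Matrix.cons_val_zero, Matrix.cons_val_one, Matrix.cons_val_two, Matrix.head_cons,
    Matrix.tail_cons, map_neg, map_pow, map_add, aeval_X]
  have hs : 0 < y 0 + y 1 := by positivity
  have hy2 : y 2 < 1 := by nlinarith
  have hs' : (y 0 + y 1) ≠ 0 := hs.ne'
  have hy0 : y 0 ≠ 0 := h0.ne'
  have hy2' : y 2 ≠ 0 := (lt_trans h0 h02).ne'
  have h1y0 : 1 - y 0 ≠ 0 := by apply ne_of_gt; linarith
  have h1y2 : 1 - y 2 ≠ 0 := by apply ne_of_gt; linarith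
  have h1uv : 1 - y 0 - y 1 ≠ 0 := by apply ne_of_gt; linarith
  have hkey : y 0 / (y 0 + y 1) - y 0 = y 0 * (1 - y 0 - y 1) / (y 0 + y 1) := by
    field_simp
    ring
  rw [neg_div, abs_neg, abs_of_pos (div_pos h0 (pow_pos hs 2)), hkey]
  field_simp

/-- Pull-back identity for `C_F`: `gF(u,v,s) = F_dih(s, u/(u+v), u) · |u/(u+v)²|` on `BF`.
[folklore] -/
theorem hgh_chartF : ∀ y ∈ {f : Fin 3 → ℝ | 0 < f 0 ∧ 0 < f 1 ∧ f 0 + f 1 < 1 ∧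
      f 0 < f 2 * (f 0 + f 1) ∧ f 2 < 1},
    (fun f : Fin 3 → ℝ => 1 / ((1 - f 0) * f 1 * f 2)) y =
    (fun t : Fin 3 → ℝ => 1 / (t 0 * t 1 * (1 - t 1) * (1 - t 2)))
      (fun i : Fin 3 => aeval y ((![X 2, X 0, X 0] : Fin 3 → MvPolynomial (Fin 3) ℚ) i) /
        aeval y ((![1, X 0 + X 1, 1] : Fin 3 → MvPolynomial (Fin 3) ℚ) i)) *
      |aeval y (X 0 : MvPolynomial (Fin 3) ℚ) / aeval y ((X 0 + X 1) ^ 2 : MvPolynomial (Fin 3) ℚ)| := by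
  rintro y ⟨h0, h1, h01, h02, h2⟩
  rw [chartF_apply]
  simp only [Matrix.cons_val_zero, Matrix.cons_val_one, Matrix.cons_val_two, Matrix.head_cons,
    Matrix.tail_cons, map_pow, map_add, aeval_X]
  have hs : 0 < y 0 + y 1 := by positivity
  have hs' : (y 0 + y 1) ≠ 0 := hs.ne'
  have hy0 : y 0 ≠ 0 := h0.ne'
  have hy1 : y 1 ≠ 0 := h1.ne'
  have hy2' : y 2 ≠ 0 := (pos_of_mul_pos_left (lt_trans h0 h02) hs.le).ne'
  have h1y0 : 1 - y 0 ≠ 0 := by apply ne_of_gt; linarith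
  have hkey : 1 - y 0 / (y 0 + y 1) = y 1 / (y 0 + y 1) := by
    field_simp
    ring
  rw [abs_of_pos (div_pos h0 (pow_pos hs 2)), hkey]
  field_simp

end DihedralCharts

open DihedralCharts in
/-- **stub_dihedralCharts**: the two dihedral charts. From `BE`, `C_E(u,v,s) = (u/(u+v), s, u)`
maps onto the simplex `1 > t₀ > t₁ > t₂ > 0` with `|J| = u/(u+v)²` and pulls
`E_dih = (t₁−t₂)/(t₀(t₀−t₂)(1−t₂)(1−t₁)t₁)` back to `(s−u)/(u(1−u)(1−s)(1−u−v)s)`; from `BF`,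
`C_F(u,v,s) = (s, u/(u+v), u)` maps onto the same simplex with `|J| = u/(u+v)²` and pulls
`F_dih = 1/(t₀t₁(1−t₁)(1−t₂))` back to `1/((1−u)vs)`. Each half is ONE change of variables
(rule (2)) along a rational chart (`ratChart_transport`; the Jacobian matrices
`((∂ⱼPᵢ)/Qᵢ − Pᵢ(∂ⱼQᵢ)/Qᵢ²)` have rows `(v/(u+v)², −u/(u+v)², 0)` and two unit vectors, determinants
`∓u/(u+v)²`): existence of the `E`/`F` representation is transported from the given simplex
representation, and any two representations of the two shapes are KZ-equivalent.
[cite: KontsevichZagier2001, §1.2 rule (2)] -/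
theorem stub_dihedralCharts :
    (∀ d : KZ.IntegralRep 3, d.domain = {t : Fin 3 → ℝ | 1 > t 0 ∧ t 0 > t 1 ∧ t 1 > t 2 ∧ t 2 > 0} →
      Set.EqOn d.integrand (fun t => (t 1 - t 2) / (t 0 * (t 0 - t 2) * (1 - t 2) * (1 - t 1) * t 1)) d.domain →
      ∃ e : KZ.IntegralRep 3, e.domain = {e : Fin 3 → ℝ | 0 < e 0 ∧ 0 < e 1 ∧ e 0 + e 1 < 1 ∧ e 0 < e 2 ∧ e 2 * (e 0 + e 1) < e 0} ∧
        e.integrand = fun e => (e 2 - e 0) / (e 0 * (1 - e 0) * (1 - e 2) * (1 - e 0 - e 1) * e 2)) ∧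
    (∀ e d : KZ.IntegralRep 3, e.domain = {e : Fin 3 → ℝ | 0 < e 0 ∧ 0 < e 1 ∧ e 0 + e 1 < 1 ∧ e 0 < e 2 ∧ e 2 * (e 0 + e 1) < e 0} →
      Set.EqOn e.integrand (fun e => (e 2 - e 0) / (e 0 * (1 - e 0) * (1 - e 2) * (1 - e 0 - e 1) * e 2)) e.domain →
      d.domain = {t : Fin 3 → ℝ | 1 > t 0 ∧ t 0 > t 1 ∧ t 1 > t 2 ∧ t 2 > 0} →
      Set.EqOn d.integrand (fun t => (t 1 - t 2) / (t 0 * (t 0 - t 2) * (1 - t 2) * (1 - t 1) * t 1)) d.domain →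
      KZ.Equivalent e d) ∧
    (∀ d : KZ.IntegralRep 3, d.domain = {t : Fin 3 → ℝ | 1 > t 0 ∧ t 0 > t 1 ∧ t 1 > t 2 ∧ t 2 > 0} →
      Set.EqOn d.integrand (fun t => 1 / (t 0 * t 1 * (1 - t 1) * (1 - t 2))) d.domain →
      ∃ f : KZ.IntegralRep 3, f.domain = {f : Fin 3 → ℝ | 0 < f 0 ∧ 0 < f 1 ∧ f 0 + f 1 < 1 ∧ f 0 < f 2 * (f 0 + f 1) ∧ f 2 < 1} ∧
        f.integrand = fun f => 1 / ((1 - f 0) * f 1 * f 2)) ∧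
    (∀ f d : KZ.IntegralRep 3, f.domain = {f : Fin 3 → ℝ | 0 < f 0 ∧ 0 < f 1 ∧ f 0 + f 1 < 1 ∧ f 0 < f 2 * (f 0 + f 1) ∧ f 2 < 1} →
      Set.EqOn f.integrand (fun f => 1 / ((1 - f 0) * f 1 * f 2)) f.domain →
      d.domain = {t : Fin 3 → ℝ | 1 > t 0 ∧ t 0 > t 1 ∧ t 1 > t 2 ∧ t 2 > 0} →
      Set.EqOn d.integrand (fun t => 1 / (t 0 * t 1 * (1 - t 1) * (1 - t 2))) d.domain →
      KZ.Equivalent f d) := by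
  -- the `E` chart: one rule-2 move along `C_E = P/Q : BE → Δ₃`, `det = −u/(u+v)²`
  have TE := ratChart_transport (![X 0, X 2, X 0]) (![X 0 + X 1, 1, 1]) (-X 0) ((X 0 + X 1) ^ 2)
    isSemialgebraic_BE (fun y hy => aeval_QE_ne_zero y hy.1 hy.2.1)
    (fun y hy => aeval_JQ_ne_zero y hy.1 hy.2.1)
    (fun y _ => by simp [Matrix.det_fin_three, neg_div]) injOn_chartE
    (fun e : Fin 3 → ℝ => (e 2 - e 0) / (e 0 * (1 - e 0) * (1 - e 2) * (1 - e 0 - e 1) * e 2))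
    (fun t : Fin 3 → ℝ => (t 1 - t 2) / (t 0 * (t 0 - t 2) * (1 - t 2) * (1 - t 1) * t 1))
    hgh_chartE
  rw [image_chartE] at TE
  -- the `F` chart: one rule-2 move along `C_F = P/Q : BF → Δ₃`, `det = u/(u+v)²`
  have TF := ratChart_transport (![X 2, X 0, X 0]) (![1, X 0 + X 1, 1]) (X 0) ((X 0 + X 1) ^ 2)
    isSemialgebraic_BF (fun y hy => aeval_QF_ne_zero y hy.1 hy.2.1)
    (fun y hy => aeval_JQ_ne_zero y hy.1 hy.2.1)
    (fun y _ => by simp [Matrix.det_fin_three]) injOn_chartF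
    (fun f : Fin 3 → ℝ => 1 / ((1 - f 0) * f 1 * f 2))
    (fun t : Fin 3 → ℝ => 1 / (t 0 * t 1 * (1 - t 1) * (1 - t 2)))
    hgh_chartF
  rw [image_chartF] at TF
  exact ⟨TE.1, fun e d hed hei hdd hdi => TE.2.2 e d hed (hed ▸ hei) hdd hdi, TF.1,
    fun f d hfd hfi hdd hdi => TF.2.2 f d hfd (hfd ▸ hfi) hdd hdi⟩

end Summit.KontsevichZagierPeriods.LinRedNormalForm.WheelThreeSpokes
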